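import Summits.QuantumFields.YangMills.Theorems.PoincareLipschitzSobolevShellInterpolationBalls
import Summits.QuantumFields.YangMills.Theorems.PoincareLipschitzProjectionAveragingContinuum
import Summits.QuantumFields.YangMills.Theorems.PoincareLipschitzSphereRayProjection
import Summits.QuantumFields.YangMills.Theorems.PoincareLipschitzSobolevRayProjectionComp
import Literature.Analysis.FunctionSpaces.MeyersSerrinProofs
import HarnessLib

/-!
# LINE 25 «CompactnessTransfer» (K2 crux `BlockLipschitzL` stmt-QuantumFields-23533 ∕ crux `HistoryTailL` stmt-QuantumFields-19936), S1″ row (C)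
# «MinimisingMapCompactness» proof project (w2 g13 lineage), brick (C-bc) «THE HARDT–KINDERLEHRER–LIN SHELL COMPETITOR»:
# a UNIT Sobolev competitor `W` on the cube agreeing with `U` on `B_{ρ₁}(y)` and with `u` off `B_{ρ₂}(y)`, whose shell energy is
# `≤ K·(E(U; shell) + E(u; shell) + (ρ₂ − ρ₁)⁻²·‖U − u‖²_{L²(shell)})` — UNCONDITIONAL (knit of (C-c′) ⊕ (C-b-AVG) ⊕ (C-b) ⊕ the ray projection)

Cell `ym3-torus` (YM ladder rung R3 = continuum SU(2) Yang–Mills on the three-torus — a RUNG, NOT the Clay problem: not `d = 4`, not infinite volume,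
not a mass gap); width seat `ym-ust-19936-w4` gen 15 (w2 g13 2026-08-29T14:30:33Z «OFFER B (C-bc) YES — YOURS — with THIS frozen conclusion»).
THEOREMS ONLY (def-free); `--supports` the K2 crux as a helper.  CONSTRUCTION ([HardtKinderlehrerLin1986] §2, the projection device replacing
Luckhaus' lemma for sphere targets; [Simon1996] §2.8): `w := χ•U + (1−χ)•u` (✓(C-c′) `exists_ball_interpolant_energy`, tree cut-off), a centre `p`,
`‖p‖ < ½`, chosen by ✓(C-b-AVG) `exists_centre_weightedIntegral_le_of_countable` OUTSIDE the countable set of atoms of `w` (so the fibre `{w = p}` is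
null) with `∫_shell dens(Gw)·‖w − p‖⁻² ≤ A·∫_shell dens(Gw)`; `W := π_p ∘ w` (the ray projection of ✓`PoincareLipschitzSphereRayProjection`, spelled out),
set to `u` on the null fibre and off the cube; `π_p` FIXES the sphere, so `W = w` wherever `w` is unit — on both caps, everywhere.
* §1 letters: `cube_subset_ball_two` ∕ `volume_cube_lt_top`; `aestronglyMeasurable_dens`; ★`exists_countable_null_fibres` (the atoms of an a.e.-measurable
  map into `ℝ⁴` are countable — Mathlib `Measure.countable_meas_level_set_pos₀`); ★`integrableOn_weight_of_caps` (the weight `dens(Gw)·‖w − p‖⁻²` is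
  integrable on the cube once it is on the shell: off the shell `w` is unit and `‖w − p‖ ≥ ½`); ★`exists_unit_modification` (the everywhere-unit
  representative `W` of `π_p ∘ w`, `W =ᵐ π_p ∘ w` on the cube, `W = w` where `w` is unit, `W = u` off the cube).
* §2 ★★★`exists_hkl_competitor` — w2's FROZEN CONCLUSION (14:30:33Z), UNCONDITIONAL: the (C-b) row is ★w3 g15's ✓`hasWeakFDerivOn_rayProj_comp` ⊕
  `dens_rayProj_comp_le` (knit of px22 g7's (C-b-α) calculus and w3's (C-b-β) chain rule), fed with `hInt` from the §1 letter `inv_mul_opNorm_le`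
  (`‖w − p‖⁻¹·‖Gw‖ ≤ ½·dens(Gw)·‖w − p‖⁻² + 3∕2`, so the HKL weight's integrability on the cube gives local integrability of `‖w − p‖⁻¹·‖Gw‖`).
  `K := 108·A·(1 + M²)` (`A` = px22's averaging constant ✓`averagingConst_nonneg`, `M` = the cut-off constant of ✓`exists_ball_interpolant_energy`).
HONEST: a knit; (C) `MinimisingMapCompactness`, (RS), S1″, the organ, K1, `MeanDeviationL`, `BlockLipschitzL`, `HistoryTailL` are NOT proved here.
-/

set_option autoImplicit false

noncomputable section

open MeasureTheory Set Filter Topology TopologicalSpace Metric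
open scoped NNReal BigOperators InnerProductSpace
open RealInnerProductSpace

namespace Summit.QuantumFields.YangMills.Theorems.PoincareLipschitzHKLCompetitor

open Literature.Analysis.FunctionSpaces (HasWeakFDerivOn)
open Literature.Analysis.FunctionSpaces.MeyersSerrin (hasWeakFDerivOn_congr_ae)
open Summit.QuantumFields.YangMills.Theorems.PoincareLipschitzSobolevShellInterpolationBalls (exists_ball_interpolant_energy)
open Summit.QuantumFields.YangMills.Theorems.PoincareLipschitzProjectionAveragingContinuum
  (exists_centre_weightedIntegral_le_of_countable averagingConst_nonneg)
open Summit.QuantumFields.YangMills.Theorems.PoincareLipschitzSphereRayProjection (norm_rayProj_eq_one rayProj_eq_self_of_norm_eq_one)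
open Summit.QuantumFields.YangMills.Theorems.PoincareLipschitzSobolevRayProjectionComp (hasWeakFDerivOn_rayProj_comp dens_rayProj_comp_le)

/-! ## §1 Letters -/

/-- The open unit cube `{|xᵢ| < 1}` of `ℝ³` lies in the ball `B_2(0)` (`‖x‖² = Σ xᵢ² ≤ 3 < 4`). [folklore] -/
theorem cube_subset_ball_two :
    {x : EuclideanSpace ℝ (Fin 3) | ∀ i : Fin 3, |x i| < 1} ⊆ ball (0 : EuclideanSpace ℝ (Fin 3)) 2 := by
  intro x hx
  rw [mem_ball_zero_iff, EuclideanSpace.norm_eq]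
  have hs : ∑ i : Fin 3, ‖x i‖ ^ 2 ≤ 3 := by
    have h1 : ∀ i : Fin 3, ‖x i‖ ^ 2 ≤ 1 := fun i => by
      rw [Real.norm_eq_abs]
      have := hx i
      nlinarith [abs_nonneg (x i)]
    calc ∑ i : Fin 3, ‖x i‖ ^ 2 ≤ ∑ _i : Fin 3, (1:ℝ) := Finset.sum_le_sum fun i _ => h1 i
      _ = 3 := by simp
  calc Real.sqrt (∑ i : Fin 3, ‖x i‖ ^ 2) ≤ Real.sqrt 3 := Real.sqrt_le_sqrt hs
    _ < 2 := by rw [Real.sqrt_lt' (by norm_num)]; norm_num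

/-- The open unit cube of `ℝ³` has finite volume. [folklore] -/
theorem volume_cube_lt_top : volume {x : EuclideanSpace ℝ (Fin 3) | ∀ i : Fin 3, |x i| < 1} < ⊤ :=
  (measure_mono cube_subset_ball_two).trans_lt measure_ball_lt_top

/-- The S1″ density `x ↦ Σᵢ ‖G x eᵢ‖²` is a.e.-strongly measurable when `G` is. [folklore] -/
theorem aestronglyMeasurable_dens {μ : Measure (EuclideanSpace ℝ (Fin 3))}
    {G : EuclideanSpace ℝ (Fin 3) → (EuclideanSpace ℝ (Fin 3) →L[ℝ] EuclideanSpace ℝ (Fin 4))} (hG : AEStronglyMeasurable G μ) :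
    AEStronglyMeasurable (fun x => ∑ i : Fin 3, ‖G x (EuclideanSpace.single i (1:ℝ))‖ ^ 2) μ :=
  Finset.aestronglyMeasurable_fun_sum _ fun i _ => (hG.apply_continuousLinearMap (EuclideanSpace.single i (1:ℝ))).norm.pow 2

/-- The operator norm of a linear map on `ℝ³` is at most the SUM of the norms of the images of the coordinate vectors:
`‖T‖ ≤ Σᵢ ‖T eᵢ‖` (`v = Σ vᵢ eᵢ`, `|vᵢ| ≤ ‖v‖`). [folklore] -/
theorem opNorm_le_sum_norm_apply_single {F : Type*} [NormedAddCommGroup F] [NormedSpace ℝ F]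
    (T : EuclideanSpace ℝ (Fin 3) →L[ℝ] F) :
    ‖T‖ ≤ ∑ i : Fin 3, ‖T (EuclideanSpace.single i (1:ℝ))‖ := by
  refine ContinuousLinearMap.opNorm_le_bound _ (Finset.sum_nonneg fun i _ => norm_nonneg _) fun v => ?_
  have hv : T v = ∑ i : Fin 3, v i • T (EuclideanSpace.single i (1:ℝ)) := by
    conv_lhs => rw [← (EuclideanSpace.basisFun (Fin 3) ℝ).sum_repr v]
    rw [map_sum]
    refine Finset.sum_congr rfl fun i _ => ?_
    rw [map_smul, EuclideanSpace.basisFun_repr, EuclideanSpace.basisFun_apply]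
  have hvi : ∀ i : Fin 3, |v i| ≤ ‖v‖ := fun i => by
    rw [EuclideanSpace.norm_eq]
    refine Real.le_sqrt_of_sq_le ?_
    have : |v i| ^ 2 = ‖v i‖ ^ 2 := by rw [Real.norm_eq_abs]
    rw [this]
    exact Finset.single_le_sum (f := fun j => ‖v j‖ ^ 2) (fun j _ => sq_nonneg _) (Finset.mem_univ i)
  rw [hv, Finset.sum_mul]
  refine (norm_sum_le _ _).trans (Finset.sum_le_sum fun i _ => ?_)
  rw [norm_smul, Real.norm_eq_abs, mul_comm]
  exact mul_le_mul_of_nonneg_left (hvi i) (norm_nonneg _)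

/-- ★ The HKL weight dominates the chain-rule integrand: for `r ≥ 0`, `r·‖T‖ ≤ ½·(Σᵢ ‖T eᵢ‖²)·r² + 3∕2` (AM–GM per coordinate on
`opNorm_le_sum_norm_apply_single`). Used with `r := ‖w x − p‖⁻¹`. [folklore] -/
theorem inv_mul_opNorm_le {F : Type*} [NormedAddCommGroup F] [NormedSpace ℝ F]
    (T : EuclideanSpace ℝ (Fin 3) →L[ℝ] F) {r : ℝ} (hr : 0 ≤ r) :
    r * ‖T‖ ≤ 2⁻¹ * ((∑ i : Fin 3, ‖T (EuclideanSpace.single i (1:ℝ))‖ ^ 2) * r ^ 2) + 3 / 2 := by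
  have h1 : r * ‖T‖ ≤ ∑ i : Fin 3, r * ‖T (EuclideanSpace.single i (1:ℝ))‖ := by
    rw [← Finset.mul_sum]
    exact mul_le_mul_of_nonneg_left (opNorm_le_sum_norm_apply_single T) hr
  have h2 : ∀ i : Fin 3, r * ‖T (EuclideanSpace.single i (1:ℝ))‖ ≤ 2⁻¹ * (‖T (EuclideanSpace.single i (1:ℝ))‖ ^ 2 * r ^ 2) + 2⁻¹ :=
    fun i => by nlinarith [sq_nonneg (r * ‖T (EuclideanSpace.single i (1:ℝ))‖ - 1)]
  refine h1.trans ((Finset.sum_le_sum fun i _ => h2 i).trans (le_of_eq ?_))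
  simp only [Finset.sum_add_distrib, Finset.sum_const, Finset.card_univ, Fintype.card_fin, nsmul_eq_mul, Finset.sum_mul,
    Finset.mul_sum]
  norm_num

/-- ★ **The atoms of an a.e.-measurable map into `ℝ⁴` are countable**: for an s-finite measure `μ` on `ℝ³` and `w` a.e.-strongly measurable,
there is a countable `N ⊂ ℝ⁴` off which every fibre `{w = p}` is `μ`-null (disjoint level sets; Mathlib `countable_meas_level_set_pos₀`). [folklore] -/
theorem exists_countable_null_fibres (μ : Measure (EuclideanSpace ℝ (Fin 3))) [SFinite μ]
    {w : EuclideanSpace ℝ (Fin 3) → EuclideanSpace ℝ (Fin 4)} (hw : AEStronglyMeasurable w μ) :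
    ∃ N : Set (EuclideanSpace ℝ (Fin 4)), N.Countable ∧ ∀ p ∉ N, μ {x | w x = p} = 0 := by
  refine ⟨{p | 0 < μ {x | w x = p}}, Measure.countable_meas_level_set_pos₀ hw.aemeasurable.nullMeasurable, fun p hp => ?_⟩
  simpa only [mem_setOf_eq, not_lt, nonpos_iff_eq_zero] using hp

/-- ★ **The HKL weight is integrable on the cube once it is on the shell.**  If `dens(Gw)` is integrable on a measurable `Q`, the weight
`dens(Gw)·(‖w − p‖²)⁻¹` is integrable on a measurable `S`, and off `S` (inside `Q`) the map `w` is unit while `‖p‖ ≤ ½` (so `‖w − p‖ ≥ ½` and the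
weight is `≤ 4·dens(Gw)` there), then the weight is integrable on `Q`. [folklore] [cite: HardtKinderlehrerLin1986, §2] -/
theorem integrableOn_weight_of_caps {Q S : Set (EuclideanSpace ℝ (Fin 3))} (hQm : MeasurableSet Q) (hS : MeasurableSet S)
    {w : EuclideanSpace ℝ (Fin 3) → EuclideanSpace ℝ (Fin 4)}
    {Gw : EuclideanSpace ℝ (Fin 3) → (EuclideanSpace ℝ (Fin 3) →L[ℝ] EuclideanSpace ℝ (Fin 4))} {p : EuclideanSpace ℝ (Fin 4)}
    (hp : ‖p‖ ≤ 1 / 2) (hwm : AEStronglyMeasurable w (volume.restrict Q)) (hGwm : AEStronglyMeasurable Gw (volume.restrict Q))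
    (hd : IntegrableOn (fun x => ∑ i : Fin 3, ‖Gw x (EuclideanSpace.single i (1:ℝ))‖ ^ 2) Q volume)
    (hSw : IntegrableOn (fun x => (∑ i : Fin 3, ‖Gw x (EuclideanSpace.single i (1:ℝ))‖ ^ 2) * (‖w x - p‖ ^ 2)⁻¹) S volume)
    (hcap : ∀ x ∈ Q, x ∉ S → ‖w x‖ = 1) :
    IntegrableOn (fun x => (∑ i : Fin 3, ‖Gw x (EuclideanSpace.single i (1:ℝ))‖ ^ 2) * (‖w x - p‖ ^ 2)⁻¹) Q volume := by
  set f : EuclideanSpace ℝ (Fin 3) → ℝ := fun x => (∑ i : Fin 3, ‖Gw x (EuclideanSpace.single i (1:ℝ))‖ ^ 2) * (‖w x - p‖ ^ 2)⁻¹ with hf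
  -- the indicator of the shell part is integrable on `Q`
  have h1 : IntegrableOn (S.indicator f) Q volume := by
    rw [IntegrableOn, integrable_indicator_iff hS, IntegrableOn, Measure.restrict_restrict hS]
    exact hSw.mono_set inter_subset_left
  have hg : IntegrableOn (fun x => S.indicator f x + 4 * ∑ i : Fin 3, ‖Gw x (EuclideanSpace.single i (1:ℝ))‖ ^ 2) Q volume :=
    h1.add (hd.const_mul 4)
  have hfm : AEStronglyMeasurable f (volume.restrict Q) := by
    have h2 : AEMeasurable (fun x => (‖w x - p‖ ^ 2)⁻¹) (volume.restrict Q) :=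
      ((hwm.aemeasurable.sub_const p).norm.pow_const 2).inv
    exact ((aestronglyMeasurable_dens hGwm).aemeasurable.mul h2).aestronglyMeasurable
  refine Integrable.mono' hg hfm ((ae_restrict_iff' hQm).mpr (ae_of_all _ fun x hxQ => ?_))
  have hd0 : 0 ≤ ∑ i : Fin 3, ‖Gw x (EuclideanSpace.single i (1:ℝ))‖ ^ 2 := Finset.sum_nonneg fun i _ => by positivity
  have hf0 : 0 ≤ f x := mul_nonneg hd0 (inv_nonneg.mpr (sq_nonneg _))
  rw [Real.norm_of_nonneg hf0]
  by_cases hxS : x ∈ S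
  · rw [indicator_of_mem hxS]
    linarith
  · rw [indicator_of_notMem hxS, zero_add]
    have h1x : ‖w x‖ = 1 := hcap x hxQ hxS
    have hge : 1 / 2 ≤ ‖w x - p‖ := by
      have := norm_sub_norm_le (w x) p
      linarith
    have hsq : 1 / 4 ≤ ‖w x - p‖ ^ 2 := by nlinarith
    have hinv : (‖w x - p‖ ^ 2)⁻¹ ≤ 4 := by
      calc (‖w x - p‖ ^ 2)⁻¹ ≤ (1 / 4 : ℝ)⁻¹ := inv_anti₀ (by norm_num) hsq
        _ = 4 := by norm_num
    calc f x = (∑ i : Fin 3, ‖Gw x (EuclideanSpace.single i (1:ℝ))‖ ^ 2) * (‖w x - p‖ ^ 2)⁻¹ := rfl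
      _ ≤ (∑ i : Fin 3, ‖Gw x (EuclideanSpace.single i (1:ℝ))‖ ^ 2) * 4 := mul_le_mul_of_nonneg_left hinv hd0
      _ = 4 * ∑ i : Fin 3, ‖Gw x (EuclideanSpace.single i (1:ℝ))‖ ^ 2 := by ring

/-- ★ **The everywhere-unit representative of `π_p ∘ w`.**  With `‖p‖ ≤ ½`, `u` unit on a measurable `Q`, and the fibre `{w = p}` null in `Q`:
`W x := π_p (w x)` for `x ∈ Q` off the fibre, `W x := u x` on the fibre and off `Q`.  Then `W` is unit on `Q`, `W = π_p ∘ w` a.e. on `Q`,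
`W = w` wherever `w` is unit in `Q` (`π_p` fixes the sphere), and `W = u` off `Q`.  (`π_p y = p + s(p,e_y)•e_y`, `e_y = ‖y − p‖⁻¹•(y − p)`, spelled
out as in ✓`PoincareLipschitzSphereRayProjection`.) [cite: HardtKinderlehrerLin1986, §2] -/
theorem exists_unit_modification {Q : Set (EuclideanSpace ℝ (Fin 3))} (hQm : MeasurableSet Q)
    {w u : EuclideanSpace ℝ (Fin 3) → EuclideanSpace ℝ (Fin 4)} {p : EuclideanSpace ℝ (Fin 4)} (hp : ‖p‖ ≤ 1 / 2)
    (hu1 : ∀ x ∈ Q, ‖u x‖ = 1) (hnull : volume.restrict Q {x | w x = p} = 0) :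
    ∃ W : EuclideanSpace ℝ (Fin 3) → EuclideanSpace ℝ (Fin 4),
      (∀ x ∈ Q, ‖W x‖ = 1) ∧
      (W =ᵐ[volume.restrict Q] fun x =>
        p + (-⟪p, ‖w x - p‖⁻¹ • (w x - p)⟫ + Real.sqrt (⟪p, ‖w x - p‖⁻¹ • (w x - p)⟫ ^ 2 + (1 - ‖p‖ ^ 2))) •
          (‖w x - p‖⁻¹ • (w x - p))) ∧
      (∀ x ∈ Q, ‖w x‖ = 1 → W x = w x) ∧ (∀ x, x ∉ Q → W x = u x) := by
  classical
  set π : EuclideanSpace ℝ (Fin 4) → EuclideanSpace ℝ (Fin 4) := fun z =>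
    p + (-⟪p, ‖z - p‖⁻¹ • (z - p)⟫ + Real.sqrt (⟪p, ‖z - p‖⁻¹ • (z - p)⟫ ^ 2 + (1 - ‖p‖ ^ 2))) • (‖z - p‖⁻¹ • (z - p)) with hπ
  refine ⟨fun x => if x ∈ Q then (if w x = p then u x else π (w x)) else u x, fun x hx => ?_, ?_, fun x hx h1 => ?_, fun x hx => ?_⟩
  · by_cases hwp : w x = p
    · simp only [hx, hwp, if_true]
      exact hu1 x hx
    · simp only [hx, hwp, if_true, if_false, hπ]
      exact norm_rayProj_eq_one p (w x) hp hwp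
  · have hae : ∀ᵐ x ∂(volume.restrict Q), x ∉ {x | w x = p} := measure_eq_zero_iff_ae_notMem.1 hnull
    filter_upwards [hae, ae_restrict_mem hQm] with x hx hxQ
    have hx' : ¬ w x = p := hx
    simp only [hxQ, hx', if_true, if_false, hπ]
  · have hwp : w x ≠ p := by
      intro h; rw [h] at h1; linarith
    simp only [hx, hwp, if_true, if_false, hπ]
    exact rayProj_eq_self_of_norm_eq_one p (w x) hp h1
  · simp only [hx, if_false]

/-- The chain-rule integrand `‖w − p‖⁻¹·‖Gw‖` is integrable on a finite-volume measurable `Q` once the HKL weight `dens(Gw)·‖w − p‖⁻²` is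
(`inv_mul_opNorm_le`). [folklore] -/
theorem integrableOn_inv_norm_mul_opNorm {Q : Set (EuclideanSpace ℝ (Fin 3))} (hQfin : volume Q < ⊤)
    {w : EuclideanSpace ℝ (Fin 3) → EuclideanSpace ℝ (Fin 4)}
    {Gw : EuclideanSpace ℝ (Fin 3) → (EuclideanSpace ℝ (Fin 3) →L[ℝ] EuclideanSpace ℝ (Fin 4))} {p : EuclideanSpace ℝ (Fin 4)}
    (hwm : AEStronglyMeasurable w (volume.restrict Q)) (hGwm : AEStronglyMeasurable Gw (volume.restrict Q))
    (hQw : IntegrableOn (fun x => (∑ i : Fin 3, ‖Gw x (EuclideanSpace.single i (1:ℝ))‖ ^ 2) * (‖w x - p‖ ^ 2)⁻¹) Q volume) :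
    IntegrableOn (fun x => ‖w x - p‖⁻¹ * ‖Gw x‖) Q volume := by
  haveI : IsFiniteMeasure (volume.restrict Q) := ⟨by rw [Measure.restrict_apply_univ]; exact hQfin⟩
  have hg : IntegrableOn (fun x => 2⁻¹ * ((∑ i : Fin 3, ‖Gw x (EuclideanSpace.single i (1:ℝ))‖ ^ 2) * (‖w x - p‖ ^ 2)⁻¹) + 3 / 2)
      Q volume :=
    (hQw.const_mul 2⁻¹).add (integrable_const _)
  have hfm : AEStronglyMeasurable (fun x => ‖w x - p‖⁻¹ * ‖Gw x‖) (volume.restrict Q) :=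
    ((hwm.aemeasurable.sub_const p).norm.inv.mul hGwm.norm.aemeasurable).aestronglyMeasurable
  refine Integrable.mono' hg hfm (ae_of_all _ fun x => ?_)
  rw [Real.norm_of_nonneg (mul_nonneg (inv_nonneg.mpr (norm_nonneg _)) (norm_nonneg _))]
  have h := inv_mul_opNorm_le (Gw x) (inv_nonneg.mpr (norm_nonneg (w x - p)))
  rw [inv_pow] at h
  exact h

/-- The closing arithmetic of the shell bound: `I_H ≤ 36·A·I_w`, `I_w ≤ 3(X + Y + (M∕d)²Z)`, everything nonnegative ⇒
`I_H ≤ 108·A·(1 + M²)·(X + Y + d⁻²Z)`. [folklore] -/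
theorem shell_bound_arith {IH IW X Y Z A M d : ℝ} (hA : 0 ≤ A) (hX : 0 ≤ X) (hY : 0 ≤ Y) (hZ : 0 ≤ Z)
    (h1 : IH ≤ 36 * (A * IW)) (h2 : IW ≤ 3 * (X + Y + (M / d) ^ 2 * Z)) :
    IH ≤ 108 * A * (1 + M ^ 2) * (X + Y + d⁻¹ ^ 2 * Z) := by
  have h3 : 36 * (A * IW) ≤ 36 * (A * (3 * (X + Y + (M / d) ^ 2 * Z))) :=
    mul_le_mul_of_nonneg_left (mul_le_mul_of_nonneg_left h2 hA) (by norm_num)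
  have h4 : 36 * (A * (3 * (X + Y + (M / d) ^ 2 * Z))) ≤ 108 * A * (1 + M ^ 2) * (X + Y + d⁻¹ ^ 2 * Z) := by
    rw [div_eq_mul_inv, mul_pow]
    have hpos : 0 ≤ 108 * A * M ^ 2 * X + 108 * A * M ^ 2 * Y + 108 * A * d⁻¹ ^ 2 * Z := by positivity
    nlinarith [hpos]
  exact h1.trans (h3.trans h4)

/-! ## §2 The HKL shell competitor -/

/-- ★★★ **THE HARDT–KINDERLEHRER–LIN SHELL COMPETITOR** (w2 g13's frozen conclusion, 2026-08-29T14:30:33Z).  An absolute `K ≥ 0` such that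
for unit Sobolev `u, U` on the open unit cube with integrable densities, every centre `y` and radii `0 < ρ₁ < ρ₂` with `closedBall y ρ₂ ⊆ cube`,
there is a UNIT Sobolev `W` on the cube with integrable density, `W = U` on `ball y ρ₁`, `W = u` off `ball y ρ₂`, and
`∫_{B_{ρ₂} ∖ B_{ρ₁}} dens(GW) ≤ K·(∫ dens(GU) + ∫ dens(Gu) + (ρ₂ − ρ₁)⁻²·∫ ‖U − u‖²)` over the same shell.  `W` = the ray projection `π_p` of the
cut-off interpolant `χ•U + (1−χ)•u` from an averaged centre `p` off the (countable) atom set, repaired to `u` on the null fibre `{w = p}`.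
[cite: HardtKinderlehrerLin1986, §2] [cite: Simon1996, §2.8] -/
theorem exists_hkl_competitor :
    ∃ K : ℝ, 0 ≤ K ∧ ∀ (hQ : IsOpen {x : EuclideanSpace ℝ (Fin 3) | ∀ i : Fin 3, |x i| < 1})
      (u U : EuclideanSpace ℝ (Fin 3) → EuclideanSpace ℝ (Fin 4))
      (Gu GU : EuclideanSpace ℝ (Fin 3) → (EuclideanSpace ℝ (Fin 3) →L[ℝ] EuclideanSpace ℝ (Fin 4))),
      HasWeakFDerivOn ⟨{x : EuclideanSpace ℝ (Fin 3) | ∀ i : Fin 3, |x i| < 1}, hQ⟩ volume u Gu →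
      HasWeakFDerivOn ⟨{x : EuclideanSpace ℝ (Fin 3) | ∀ i : Fin 3, |x i| < 1}, hQ⟩ volume U GU →
      (∀ x : EuclideanSpace ℝ (Fin 3), (∀ i : Fin 3, |x i| < 1) → ‖u x‖ = 1) →
      (∀ x : EuclideanSpace ℝ (Fin 3), (∀ i : Fin 3, |x i| < 1) → ‖U x‖ = 1) →
      IntegrableOn (fun x => ∑ i : Fin 3, ‖Gu x (EuclideanSpace.single i (1:ℝ))‖ ^ 2)
        {x : EuclideanSpace ℝ (Fin 3) | ∀ i : Fin 3, |x i| < 1} volume →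
      IntegrableOn (fun x => ∑ i : Fin 3, ‖GU x (EuclideanSpace.single i (1:ℝ))‖ ^ 2)
        {x : EuclideanSpace ℝ (Fin 3) | ∀ i : Fin 3, |x i| < 1} volume →
      ∀ (y : EuclideanSpace ℝ (Fin 3)) (ρ₁ ρ₂ : ℝ), 0 < ρ₁ → ρ₁ < ρ₂ →
      closedBall y ρ₂ ⊆ {x : EuclideanSpace ℝ (Fin 3) | ∀ i : Fin 3, |x i| < 1} →
      ∃ (W : EuclideanSpace ℝ (Fin 3) → EuclideanSpace ℝ (Fin 4))
        (GW : EuclideanSpace ℝ (Fin 3) → (EuclideanSpace ℝ (Fin 3) →L[ℝ] EuclideanSpace ℝ (Fin 4))),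
        HasWeakFDerivOn ⟨{x : EuclideanSpace ℝ (Fin 3) | ∀ i : Fin 3, |x i| < 1}, hQ⟩ volume W GW ∧
        (∀ x : EuclideanSpace ℝ (Fin 3), (∀ i : Fin 3, |x i| < 1) → ‖W x‖ = 1) ∧
        IntegrableOn (fun x => ∑ i : Fin 3, ‖GW x (EuclideanSpace.single i (1:ℝ))‖ ^ 2)
          {x : EuclideanSpace ℝ (Fin 3) | ∀ i : Fin 3, |x i| < 1} volume ∧
        (∀ x ∈ ball y ρ₁, W x = U x) ∧ (∀ x, x ∉ ball y ρ₂ → W x = u x) ∧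
        ∫ x in ball y ρ₂ \ ball y ρ₁, ∑ i : Fin 3, ‖GW x (EuclideanSpace.single i (1:ℝ))‖ ^ 2 ≤
          K * ((∫ x in ball y ρ₂ \ ball y ρ₁, ∑ i : Fin 3, ‖GU x (EuclideanSpace.single i (1:ℝ))‖ ^ 2) +
            (∫ x in ball y ρ₂ \ ball y ρ₁, ∑ i : Fin 3, ‖Gu x (EuclideanSpace.single i (1:ℝ))‖ ^ 2) +
            (ρ₂ - ρ₁)⁻¹ ^ 2 * ∫ x in ball y ρ₂ \ ball y ρ₁, ‖U x - u x‖ ^ 2) := by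
  obtain ⟨M, hM0, hball⟩ := exists_ball_interpolant_energy
  set A : ℝ := (∫ x in ball (0 : EuclideanSpace ℝ (Fin 4)) 2, (‖x‖ ^ 2)⁻¹) /
    (volume (ball (0 : EuclideanSpace ℝ (Fin 4)) (1 / 2))).toReal with hA
  have hA0 : 0 ≤ A := averagingConst_nonneg
  refine ⟨108 * A * (1 + M ^ 2), by positivity, fun hQ u U Gu GU hu hU hu1 hU1 hdu hdU y ρ₁ ρ₂ h1 h12 hcb => ?_⟩
  set Q : Set (EuclideanSpace ℝ (Fin 3)) := {x | ∀ i : Fin 3, |x i| < 1} with hQdef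
  have hQm : MeasurableSet Q := hQ.measurableSet
  have hQfin : volume Q < ⊤ := volume_cube_lt_top
  have hd : 0 < ρ₂ - ρ₁ := sub_pos.mpr h12
  -- the sub-unit interpolant across the two balls (inner map `U`, outer map `u`)
  obtain ⟨w, Gw, hW, hsub, hin, hout, -, -, hS⟩ :=
    hball ⟨Q, hQ⟩ u U Gu GU hu hU (fun x hx => hu1 x hx) (fun x hx => hU1 x hx) hdu hdU y ρ₁ ρ₂ h1 h12
  -- the shell
  set S : Set (EuclideanSpace ℝ (Fin 3)) := ball y ρ₂ \ ball y ρ₁ with hSdef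
  have hSm : MeasurableSet S := measurableSet_ball.diff measurableSet_ball
  have hSQ : S ⊆ Q := fun x hx => hcb (ball_subset_closedBall hx.1)
  have hSfin : volume S < ⊤ := (measure_mono fun x (hx : x ∈ S) => hx.1).trans_lt measure_ball_lt_top
  obtain ⟨hdWS, hWS⟩ := hS S hSm hSQ hSfin
  obtain ⟨hdWQ, -⟩ := hS Q hQm Subset.rfl hQfin
  have hwm : AEStronglyMeasurable w (volume.restrict Q) := hW.locallyIntegrableOn.aestronglyMeasurable
  have hGwm : AEStronglyMeasurable Gw (volume.restrict Q) := hW.locallyIntegrableOn_deriv.aestronglyMeasurable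
  -- off the shell, inside the cube, `w` is unit
  have hcap : ∀ x ∈ Q, x ∉ S → ‖w x‖ = 1 := by
    intro x hxQ hxS
    by_cases h2 : x ∈ ball y ρ₂
    · have hx1 : x ∈ ball y ρ₁ := by
        by_contra h; exact hxS ⟨h2, h⟩
      rw [(hin x (mem_ball.1 hx1).le).1]
      exact hU1 x hxQ
    · rw [(hout x (not_lt.1 fun h => h2 (mem_ball.2 h))).1]
      exact hu1 x hxQ
  -- the countable atom set of `w` and the averaged centre
  obtain ⟨N, hNc, hNnull⟩ := exists_countable_null_fibres (volume.restrict Q) hwm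
  have hc0 : 0 ≤ᵐ[volume.restrict S] fun x => ∑ i : Fin 3, ‖Gw x (EuclideanSpace.single i (1:ℝ))‖ ^ 2 :=
    Filter.Eventually.of_forall fun x => show (0 : ℝ) ≤ _ from Finset.sum_nonneg fun i _ => by positivity
  have hq1 : ∀ᵐ x ∂(volume.restrict S), ‖w x‖ ≤ 1 :=
    (ae_restrict_iff' hSm).mpr (ae_of_all _ fun x hx => hsub x (hSQ hx))
  obtain ⟨p, hp, hpN, hSw, hSwle⟩ := exists_centre_weightedIntegral_le_of_countable volume S
    (fun x => ∑ i : Fin 3, ‖Gw x (EuclideanSpace.single i (1:ℝ))‖ ^ 2) w N hdWS hc0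
    (hwm.mono_measure (Measure.restrict_mono hSQ le_rfl)) hq1 hNc
  -- the weight on the whole cube, then the (C-b) row (★w3 g15 ⊕ px22 g7)
  have hQw := integrableOn_weight_of_caps hQm hSm hp.le hwm hGwm hdWQ hSw hcap
  have hInt := integrableOn_inv_norm_mul_opNorm hQfin hwm hGwm hQw
  set H : EuclideanSpace ℝ (Fin 3) → (EuclideanSpace ℝ (Fin 3) →L[ℝ] EuclideanSpace ℝ (Fin 4)) := fun x =>
    (fderiv ℝ (fun z : EuclideanSpace ℝ (Fin 4) => p + (-⟪p, ‖z - p‖⁻¹ • (z - p)⟫ +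
      Real.sqrt (⟪p, ‖z - p‖⁻¹ • (z - p)⟫ ^ 2 + (1 - ‖p‖ ^ 2))) • (‖z - p‖⁻¹ • (z - p))) (w x)).comp (Gw x) with hHdef
  have hWH : HasWeakFDerivOn ⟨Q, hQ⟩ volume
      (fun x => p + (-⟪p, ‖w x - p‖⁻¹ • (w x - p)⟫ + Real.sqrt (⟪p, ‖w x - p‖⁻¹ • (w x - p)⟫ ^ 2 + (1 - ‖p‖ ^ 2))) •
        (‖w x - p‖⁻¹ • (w x - p))) H :=
    hasWeakFDerivOn_rayProj_comp hW p hp.le hInt.locallyIntegrableOn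
  have hHle : ∀ᵐ x ∂(volume.restrict Q), ∑ i : Fin 3, ‖H x (EuclideanSpace.single i (1:ℝ))‖ ^ 2 ≤
      36 * ((∑ i : Fin 3, ‖Gw x (EuclideanSpace.single i (1:ℝ))‖ ^ 2) * (‖w x - p‖ ^ 2)⁻¹) := by
    refine ae_of_all _ fun x => ?_
    have h := dens_rayProj_comp_le p hp.le (w := w) (Gw := Gw) x
    have e : (6 / ‖w x - p‖) ^ 2 * ∑ i : Fin 3, ‖Gw x (EuclideanSpace.single i (1:ℝ))‖ ^ 2 =
        36 * ((∑ i : Fin 3, ‖Gw x (EuclideanSpace.single i (1:ℝ))‖ ^ 2) * (‖w x - p‖ ^ 2)⁻¹) := by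
      rw [div_pow]; ring
    rw [← e]
    exact h
  -- the everywhere-unit representative
  obtain ⟨W, hW1, hWae, hWfix, hWout⟩ :=
    exists_unit_modification (u := u) hQm hp.le (fun x hx => hu1 x hx) (hNnull p hpN)
  have hWsob : HasWeakFDerivOn ⟨Q, hQ⟩ volume W H := hasWeakFDerivOn_congr_ae hWH hWae EventuallyEq.rfl
  have hHm : AEStronglyMeasurable H (volume.restrict Q) := hWH.locallyIntegrableOn_deriv.aestronglyMeasurable
  have hdHQ : IntegrableOn (fun x => ∑ i : Fin 3, ‖H x (EuclideanSpace.single i (1:ℝ))‖ ^ 2) Q volume := by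
    refine Integrable.mono' (hQw.const_mul 36) (aestronglyMeasurable_dens hHm) (hHle.mono fun x hx => ?_)
    rw [Real.norm_of_nonneg (Finset.sum_nonneg fun i _ => by positivity)]
    exact hx
  refine ⟨W, H, hWsob, fun x hx => hW1 x hx, hdHQ, fun x hx => ?_, fun x hx => ?_, ?_⟩
  · -- inner cap
    have hxQ : x ∈ Q := hcb (ball_subset_closedBall (ball_subset_ball h12.le hx))
    have hwx : w x = U x := (hin x (mem_ball.1 hx).le).1
    have h1x : ‖w x‖ = 1 := by rw [hwx]; exact hU1 x hxQ
    rw [hWfix x hxQ h1x, hwx]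
  · -- outer cap
    by_cases hxQ : x ∈ Q
    · have hwx : w x = u x := (hout x (not_lt.1 fun h => hx (mem_ball.2 h))).1
      have h1x : ‖w x‖ = 1 := by rw [hwx]; exact hu1 x hxQ
      rw [hWfix x hxQ h1x, hwx]
    · exact hWout x hxQ
  · -- the shell energy
    have hdHS : IntegrableOn (fun x => ∑ i : Fin 3, ‖H x (EuclideanSpace.single i (1:ℝ))‖ ^ 2) S volume := hdHQ.mono_set hSQ
    have h36 : IntegrableOn (fun x => 36 * ((∑ i : Fin 3, ‖Gw x (EuclideanSpace.single i (1:ℝ))‖ ^ 2) * (‖w x - p‖ ^ 2)⁻¹)) S volume :=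
      hSw.const_mul 36
    have step1 : ∫ x in S, ∑ i : Fin 3, ‖H x (EuclideanSpace.single i (1:ℝ))‖ ^ 2 ≤
        ∫ x in S, 36 * ((∑ i : Fin 3, ‖Gw x (EuclideanSpace.single i (1:ℝ))‖ ^ 2) * (‖w x - p‖ ^ 2)⁻¹) :=
      setIntegral_mono_ae_restrict hdHS h36 (ae_restrict_of_ae_restrict_of_subset hSQ hHle)
    have step2 : ∫ x in S, 36 * ((∑ i : Fin 3, ‖Gw x (EuclideanSpace.single i (1:ℝ))‖ ^ 2) * (‖w x - p‖ ^ 2)⁻¹) =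
        36 * ∫ x in S, (∑ i : Fin 3, ‖Gw x (EuclideanSpace.single i (1:ℝ))‖ ^ 2) * (‖w x - p‖ ^ 2)⁻¹ := integral_const_mul _ _
    have hX0 : 0 ≤ ∫ x in S, ∑ i : Fin 3, ‖GU x (EuclideanSpace.single i (1:ℝ))‖ ^ 2 :=
      setIntegral_nonneg hSm fun x _ => Finset.sum_nonneg fun i _ => by positivity
    have hY0 : 0 ≤ ∫ x in S, ∑ i : Fin 3, ‖Gu x (EuclideanSpace.single i (1:ℝ))‖ ^ 2 :=
      setIntegral_nonneg hSm fun x _ => Finset.sum_nonneg fun i _ => by positivity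
    have hZ0 : 0 ≤ ∫ x in S, ‖U x - u x‖ ^ 2 := setIntegral_nonneg hSm fun x _ => by positivity
    have e1 : ∫ x in S, ∑ i : Fin 3, ‖H x (EuclideanSpace.single i (1:ℝ))‖ ^ 2 ≤
        36 * (A * ∫ x in S, ∑ i : Fin 3, ‖Gw x (EuclideanSpace.single i (1:ℝ))‖ ^ 2) := by
      refine step1.trans ?_
      rw [step2]
      exact mul_le_mul_of_nonneg_left hSwle (by norm_num)
    exact shell_bound_arith hA0 hX0 hY0 hZ0 e1 hWS

end Summit.QuantumFields.YangMills.Theorems.PoincareLipschitzHKLCompetitor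

end
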